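import Literature.MathematicalPhysics.QuantumLattice.HubbardTorusMarkovRectWindow
import HarnessLib

/-!
# Two-row STAIRCASE Markov windows: the certified upper edge of the thermal energy window from a C1
# certificate on a staircase shield (all window bookkeeping discharged)

Topic `MathematicalPhysics/QuantumLattice`, namespace `Literature.MathematicalPhysics.QuantumLattice`.

`HubbardTorusMarkovRectWindow.lean` discharged the window bookkeeping of the weighted-cluster Markov certificate
theorems (`…le_of_cornerMarkovCertificate`: a window `Λ ⊆ [0,ℓ)²` with lexicographically largest site `a` and the
corner condition `a − eᵢ ∈ Λ`) for RECTANGLES. The `hubbard-thermal` producer's next shields are two-row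
STAIRCASES (`stair:a,b,c` in `hubfe.py`: a top row and a longer row below it; e.g. `stair:2,2,1` = top row of 3
sites over a bottom row of 4, the 7-site shield whose certified `π⁺(3/4) ≈ 1.27` improves the `T = t/4` edge by
≈ `0.004·t` [float, RESULT-v1 §4]). This file discharges the bookkeeping for them once:

* §1 `stairWindow lo₁ hi₁ lo₀ hi₀` = `{(1, c) : lo₁ ≤ c < hi₁} ∪ {(0, c) : lo₀ ≤ c < hi₀}` (coordinate `0` = row,
  `1` = column, the tree's `Pi.Lex` Jordan–Wigner order = the producer's raster order "bottom row, then top row,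
  corner last"); membership, the corner `A = (1, hi₁ − 1)` is a member and lexicographically largest, its
  neighbours `A − e₀ = (0, hi₁ − 1)` (needs `lo₀ + 1 ≤ hi₁ ≤ hi₀`) and `A − e₁ = (1, hi₁ − 2)` (needs `lo₁ + 2 ≤ hi₁`)
  are members, and `stairWindow ⊆ [0, max 2 (max hi₁ hi₀))²`;
* §2 the headline `IsTorusLimitOfMixture.meanEnergy_hubbardTTPrime_le_of_stairMarkovCertificate`: for every torus
  limit of the canonical sector Gibbs states (`t' = 0`, `U ≥ 0`, `0 ≤ n < 2`) at `β`, every `0 < β_h < β`, every C1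
  certificate on a staircase window at `(β_h, μ)` (corner representative `cornerEnergyRep`, structured annihilator,
  dual `L_B` on the shield `Λ ∖ A`, constant `c`) and every `T = 0` row `e(t,0,U,n) ≤ e⁺`:
  `e_Φ(ω) ≤ (c − β_h μ n + β e⁺)/(β − β_h)`.

Dictionary for `hubfe.py`'s `stair:a,b,c` (top row `x ∈ [−a, 0]`, bottom row `x ∈ [−b, c]`, shifted to `x ≥ 0` by
`s = max a b`): `lo₁ = s − a`, `hi₁ = s + 1`, `lo₀ = s − b`, `hi₀ = s + c + 1`, `A = mkSite2 1 s`; e.g. `stair:2,2,1` =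
`stairWindow 0 3 0 4`, `A = mkSite2 1 2`; `stair:2,3,0` = `stairWindow 1 4 0 4`, `A = mkSite2 1 3`.
[cite: PoulinHastings2011, eqs. (3)–(8)] (Markov bound with a dual certificate); [cite: GustafsonSigal2003, §18.3 Theorem 18.10]
(zero-entropy cold anchor). Everything is PROVED; one bookkeeping definition, no named fact.
-/

noncomputable section

namespace Literature.MathematicalPhysics.QuantumLattice

open Matrix Finset HubbardWave0 Literature.Probability.LatticeModels ThermodynamicLimit AndersonCluster
open _root_.Filter
open scoped _root_.Topology ComplexOrder MatrixOrder

/-! ### §1. Staircase windows -/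

section Stair

/-- **The two-row staircase window** `{(1, c) : lo₁ ≤ c < hi₁} ∪ {(0, c) : lo₀ ≤ c < hi₀} ⊆ ℤ²` (coordinate `0` =
row, coordinate `1` = column): the top row (row `1`) carries the distinguished corner `A = (1, hi₁ − 1)`, the
bottom row (row `0`) is the rest of the Markov past. [cite: PoulinHastings2011, eqs. (3)–(8)] -/
def stairWindow (lo₁ hi₁ lo₀ hi₀ : ℕ) : Finset (Site 2) :=
  (halfOpenBox 2 (2 + hi₁ + hi₀)).filter fun x =>
    (x 0 = 1 ∧ (lo₁ : ℤ) ≤ x 1 ∧ x 1 < hi₁) ∨ (x 0 = 0 ∧ (lo₀ : ℤ) ≤ x 1 ∧ x 1 < hi₀)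

/-- Membership in the staircase window. [cite: PoulinHastings2011, eqs. (3)–(8)] -/
theorem mem_stairWindow_iff {lo₁ hi₁ lo₀ hi₀ : ℕ} {x : Site 2} :
    x ∈ stairWindow lo₁ hi₁ lo₀ hi₀ ↔
      (x 0 = 1 ∧ (lo₁ : ℤ) ≤ x 1 ∧ x 1 < hi₁) ∨ (x 0 = 0 ∧ (lo₀ : ℤ) ≤ x 1 ∧ x 1 < hi₀) := by
  rw [stairWindow, Finset.mem_filter, mem_halfOpenBox, Fin.forall_fin_two]
  push_cast
  constructor
  · rintro ⟨-, h⟩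
    exact h
  · intro h
    refine ⟨?_, h⟩
    rcases h with ⟨h0, h1, h2⟩ | ⟨h0, h1, h2⟩
    · exact ⟨⟨by omega, by omega⟩, ⟨by omega, by omega⟩⟩
    · exact ⟨⟨by omega, by omega⟩, ⟨by omega, by omega⟩⟩

/-- The staircase sits in the box `[0, max 2 (max hi₁ hi₀))²`. [cite: PoulinHastings2011, eqs. (3)–(8)] -/
theorem stairWindow_subset_halfOpenBox (lo₁ hi₁ lo₀ hi₀ : ℕ) :
    stairWindow lo₁ hi₁ lo₀ hi₀ ⊆ halfOpenBox 2 (max 2 (max hi₁ hi₀)) := fun x hx => by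
  have h := mem_stairWindow_iff.1 hx
  have hm1 : (hi₁ : ℤ) ≤ ((max 2 (max hi₁ hi₀) : ℕ) : ℤ) := by
    exact_mod_cast (le_max_left _ _).trans (le_max_right _ _)
  have hm0 : (hi₀ : ℤ) ≤ ((max 2 (max hi₁ hi₀) : ℕ) : ℤ) := by
    exact_mod_cast (le_max_right _ _).trans (le_max_right _ _)
  have hm2 : (2 : ℤ) ≤ ((max 2 (max hi₁ hi₀) : ℕ) : ℤ) := by exact_mod_cast le_max_left _ _
  refine mem_halfOpenBox.2 (Fin.forall_fin_two.2 ?_)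
  rcases h with ⟨h0, h1, h2⟩ | ⟨h0, h1, h2⟩
  · exact ⟨⟨by omega, by omega⟩, ⟨by omega, by omega⟩⟩
  · exact ⟨⟨by omega, by omega⟩, ⟨by omega, by omega⟩⟩

/-- A top-row site `(1, c)` with `lo₁ ≤ c < hi₁` lies in the staircase. [cite: PoulinHastings2011, eqs. (3)–(8)] -/
theorem mkSite2_one_mem_stairWindow {lo₁ hi₁ lo₀ hi₀ c : ℕ} (h1 : lo₁ ≤ c) (h2 : c < hi₁) :
    mkSite2 1 c ∈ stairWindow lo₁ hi₁ lo₀ hi₀ := by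
  refine mem_stairWindow_iff.2 (Or.inl ⟨?_, ?_, ?_⟩)
  · show ((1 : ℕ) : ℤ) = 1; norm_num
  · show (lo₁ : ℤ) ≤ (c : ℤ); omega
  · show (c : ℤ) < hi₁; omega

/-- A bottom-row site `(0, c)` with `lo₀ ≤ c < hi₀` lies in the staircase. [cite: PoulinHastings2011, eqs. (3)–(8)] -/
theorem mkSite2_zero_mem_stairWindow {lo₁ hi₁ lo₀ hi₀ c : ℕ} (h1 : lo₀ ≤ c) (h2 : c < hi₀) :
    mkSite2 0 c ∈ stairWindow lo₁ hi₁ lo₀ hi₀ := by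
  refine mem_stairWindow_iff.2 (Or.inr ⟨?_, ?_, ?_⟩)
  · show ((0 : ℕ) : ℤ) = 0; norm_num
  · show (lo₀ : ℤ) ≤ (c : ℤ); omega
  · show (c : ℤ) < hi₀; omega

/-- **The corner** `A = (1, hi₁ − 1)` lies in the staircase (`lo₁ + 1 ≤ hi₁`). [cite: PoulinHastings2011, eqs. (3)–(8)] -/
theorem stairCorner_mem_stairWindow {lo₁ hi₁ lo₀ hi₀ : ℕ} (h : lo₁ + 1 ≤ hi₁) :
    mkSite2 1 (hi₁ - 1) ∈ stairWindow lo₁ hi₁ lo₀ hi₀ :=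
  mkSite2_one_mem_stairWindow (by omega) (by omega)

/-- **The corner is the lexicographically largest site of the staircase**: bottom-row sites have a smaller
row coordinate (the major one in `Pi.Lex`), top-row sites a column `≤ hi₁ − 1`. [cite: ArakiMoriya2003, §4.1 Def. 4.3] -/
theorem toLex_le_toLex_stairCorner {lo₁ hi₁ lo₀ hi₀ : ℕ} :
    ∀ y ∈ stairWindow lo₁ hi₁ lo₀ hi₀, toLex y ≤ toLex (mkSite2 1 (hi₁ - 1)) := by
  intro y hy
  rcases mem_stairWindow_iff.1 hy with ⟨h0, h1, h2⟩ | ⟨h0, h1, h2⟩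
  · refine Pi.toLex_monotone (Fin.forall_fin_two.2 ⟨?_, ?_⟩)
    · show y 0 ≤ ((1 : ℕ) : ℤ)
      omega
    · show y 1 ≤ ((hi₁ - 1 : ℕ) : ℤ)
      omega
  · refine le_of_lt ?_
    show Pi.Lex (· < ·) (· < ·) y (mkSite2 1 (hi₁ - 1))
    refine ⟨0, fun j hj => absurd hj (Fin.not_lt_zero j), ?_⟩
    show y 0 < ((1 : ℕ) : ℤ)
    omega

/-- The corner minus `e₀` is the site below it, `(0, hi₁ − 1)`. [cite: PoulinHastings2011, eqs. (3)–(8)] -/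
theorem stairCorner_sub_unitVec_zero (hi₁ : ℕ) :
    mkSite2 1 (hi₁ - 1) - unitVec (0 : Fin 2) = mkSite2 0 (hi₁ - 1) := by
  funext j
  fin_cases j
  · show ((1 : ℕ) : ℤ) - (Pi.single (0 : Fin 2) (1 : ℤ) : Site 2) 0 = ((0 : ℕ) : ℤ)
    simp
  · show ((hi₁ - 1 : ℕ) : ℤ) - (Pi.single (0 : Fin 2) (1 : ℤ) : Site 2) 1 = ((hi₁ - 1 : ℕ) : ℤ)
    simp

/-- The corner minus `e₁` is its left neighbour `(1, hi₁ − 2)` (`hi₁ ≥ 2`). [cite: PoulinHastings2011, eqs. (3)–(8)] -/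
theorem stairCorner_sub_unitVec_one {hi₁ : ℕ} (h : 2 ≤ hi₁) :
    mkSite2 1 (hi₁ - 1) - unitVec (1 : Fin 2) = mkSite2 1 (hi₁ - 2) := by
  funext j
  fin_cases j
  · show ((1 : ℕ) : ℤ) - (Pi.single (1 : Fin 2) (1 : ℤ) : Site 2) 0 = ((1 : ℕ) : ℤ)
    simp
  · show ((hi₁ - 1 : ℕ) : ℤ) - (Pi.single (1 : Fin 2) (1 : ℤ) : Site 2) 1 = ((hi₁ - 2 : ℕ) : ℤ)
    simp
    omega

/-- **The corner condition for staircases**: `A − e₀ ∈ Λ` iff the bottom row passes under the corner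
(`lo₀ + 1 ≤ hi₁ ≤ hi₀`), `A − e₁ ∈ Λ` iff the top row has a site left of the corner (`lo₁ + 2 ≤ hi₁`).
[cite: PoulinHastings2011, eqs. (3)–(8)] -/
theorem stairCorner_sub_unitVec_mem_stairWindow {lo₁ hi₁ lo₀ hi₀ : ℕ} (h₁ : lo₁ + 2 ≤ hi₁) (h₀ : lo₀ + 1 ≤ hi₁)
    (h₀' : hi₁ ≤ hi₀) (i : Fin 2) : mkSite2 1 (hi₁ - 1) - unitVec i ∈ stairWindow lo₁ hi₁ lo₀ hi₀ := by
  revert i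
  refine Fin.forall_fin_two.2 ⟨?_, ?_⟩
  · rw [stairCorner_sub_unitVec_zero hi₁]
    exact mkSite2_zero_mem_stairWindow (by omega) (by omega)
  · rw [stairCorner_sub_unitVec_one (by omega)]
    exact mkSite2_one_mem_stairWindow (by omega) (by omega)

end Stair

/-! ### §2. The certified upper edge from a staircase C1 certificate -/

section Torus

namespace InfVolFermionState

variable {t U n β : ℝ} {ω : InfVolFermionState 2} {Ls : ℕ → ℕ}

/-- **Certified upper edge of the thermal energy window from a C1 certificate on a two-row staircase.**
Let `ω` be a torus limit of the canonical sector Gibbs states of the square-lattice Hubbard model (`t' = 0`,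
`U ≥ 0`, `0 ≤ n < 2`) at `β` along `Ls → ∞`, `0 < β_h < β`, `μ` real, and `Λ = stairWindow lo₁ hi₁ lo₀ hi₀` a
staircase with `lo₁ + 2 ≤ hi₁`, `lo₀ + 1 ≤ hi₁ ≤ hi₀` (corner `A = (1, hi₁ − 1)`, shield `Λ ∖ A`). A C1 certificate
on `Λ` at `(β_h, μ)` — annihilator terms `g_i (O_i − τ_{z_i} O_i)` inside `Λ`, a Hermitian dual `L_B ∈ 𝔄_{Λ∖A}`,
a constant `c` with `e^c · exp(L_B) − tr_A exp(−β_h (h_μ + G) + Γ L_B) ⪰ 0`, `h_μ = cornerEnergyRep Λ A t U μ` —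
and a `T = 0` row `e(t,0,U,n) ≤ e⁺` give `e_Φ(ω) ≤ (c − β_h μ n + β e⁺)/(β − β_h)`.
[cite: PoulinHastings2011, eqs. (3)–(8)] [cite: GustafsonSigal2003, §18.3 Theorem 18.10] -/
theorem IsTorusLimitOfMixture.meanEnergy_hubbardTTPrime_le_of_stairMarkovCertificate
    (hU : 0 ≤ U) (hn0 : 0 ≤ n) (hn2 : n < 2)
    (h : ω.IsTorusLimitOfMixture (sectorGibbsCount n) (fun L => sectorGibbsWeightTT' β t 0 U n L)
      (fun L => sectorGibbsVectorTT' t 0 U n L) Ls)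
    (hLs : Tendsto Ls atTop atTop) {βh : ℝ} (hβh : 0 < βh) (hlt : βh < β)
    (μ : ℝ) {lo₁ hi₁ lo₀ hi₀ : ℕ} (h₁ : lo₁ + 2 ≤ hi₁) (h₀ : lo₀ + 1 ≤ hi₁) (h₀' : hi₁ ≤ hi₀)
    {ι : Type*} (s : Finset ι) (S : ι → Finset (Site 2)) (hS : ∀ i, S i ⊆ stairWindow lo₁ hi₁ lo₀ hi₀)
    (z : ι → Site 2) (hz : ∀ i, shiftSet (z i) (S i) ⊆ stairWindow lo₁ hi₁ lo₀ hi₀) {O : ∀ i, FermionOp (S i)}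
    (hO : ∀ i ∈ s, (O i).IsHermitian) (g : ι → ℝ)
    {LB : FermionOp ((stairWindow lo₁ hi₁ lo₀ hi₀).erase (mkSite2 1 (hi₁ - 1)))} (hLB : LB.IsHermitian) {c : ℝ}
    (hcert : ((Real.exp c : ℂ) • cfc Real.exp LB -
      fermionPartialTrace (PolySite.incl (Finset.erase_subset (mkSite2 1 (hi₁ - 1)) (stairWindow lo₁ hi₁ lo₀ hi₀)))
        (cfc Real.exp (-((βh : ℂ) • (cornerEnergyRep (stairWindow lo₁ hi₁ lo₀ hi₀) (mkSite2 1 (hi₁ - 1)) t U μ +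
            windowAnnihilator s (stairWindow lo₁ hi₁ lo₀ hi₀) S hS z hz O g)) +
          fermionEmbed (PolySite.incl (Finset.erase_subset (mkSite2 1 (hi₁ - 1)) (stairWindow lo₁ hi₁ lo₀ hi₀))) LB))).PosSemidef)
    {eup : ℝ} (he : energyDensityTT' t 0 U n ≤ eup) :
    ω.meanEnergy (hubbardTTPrimeFermionInteraction t 0 U) 1 ≤ (c - βh * μ * n + β * eup) / (β - βh) :=
  h.meanEnergy_hubbardTTPrime_le_of_cornerMarkovCertificate hU hn0 hn2 hLs hβh hlt μ
    (stairCorner_mem_stairWindow (by omega)) toLex_le_toLex_stairCorner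
    (stairCorner_sub_unitVec_mem_stairWindow h₁ h₀ h₀') (stairWindow_subset_halfOpenBox lo₁ hi₁ lo₀ hi₀)
    s S hS z hz hO g hLB hcert he

end InfVolFermionState

end Torus

end Literature.MathematicalPhysics.QuantumLattice

end
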